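import Literature.MathematicalPhysics.QuantumLattice.ClusterProductStates
import Literature.MathematicalPhysics.QuantumLattice.HubbardBondAlgebra
import Literature.MathematicalPhysics.QuantumLattice.PlaquettePairCouplings
import HarnessLib

/-!
# The partition of the `2M × 2M` fermionic torus into `2 × 2` plaquettes

The checkerboard Hubbard torus of side `L = 2M` (Tsai–Kivelson 2006; Yao–Tsai–Kivelson 2007,
Fig. 1) is the union of the `M²` plaquettes `R + {0,1}²`, `R ∈ (2ℤ/Lℤ)²`; in the summit's statements
the block of a site `x : FermionTorus 2 L` is `fun i => (x i : ℕ) / 2`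
(`SimpleGraph.comap (fun x i => (x i : ℕ)/2) ⊤` separates intra- from inter-plaquette bonds). This
file realises the plaquettes as an ORDERED PARTITION of the orbital set `Orb (FermionTorus 2 (2M))`
in the sense of `ClusterProduct.Partition` (`ClusterProductStates`), so that the Koszul-signed
product states `⊗_R ψ_R` of plaquette vectors and the locality of even plaquette operators
(`jwEmbed_mulVec_prodFamily`) become available for the plaquette-boson dictionary:

* `plaqSite M R : PlaquetteSite → FermionTorus 2 (2M)`, `a ↦ 2R + a` (coordinatewise), strictly
  monotone for the lexicographic site orders (`plaqSite_strictMono`), hence the order embeddings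
  `plaqSiteEmb M R` and `plaqOrbEmb M R = orbEmb (plaqSiteEmb M R)` (orbitals: `(x, σ) ↦ (2R + x, σ)`);
* `blockOf M x = x / 2`, `posOf M x = x % 2` (coordinatewise) and
  **`plaquettePartition M : Partition (Orb (FermionTorus 2 (2M))) (FermionTorus 2 M) (Orb PlaquetteSite)`**
  (clusters ordered lexicographically by `R`);
* `blockOf_eq_iff`: two sites lie in the same plaquette iff the summit's block map agrees on them.

References: W.-F. Tsai, S. A. Kivelson, PRB 73 (2006) 214510, §I; H. Yao, W.-F. Tsai, S. A. Kivelson,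
PRB 76 (2007) 161104(R), Fig. 1 [YaoTsaiKivelson2007]. Tree: `orbEmb` (`HubbardBondAlgebra`),
`PlaquetteSite` (`PlaquettePairCouplings`), `ClusterProduct.Partition` (`ClusterProductStates`).
-/

noncomputable section

namespace Literature.MathematicalPhysics.QuantumLattice

open Matrix Finset

namespace TorusPlaquette

variable (M : ℕ)

/-- The site `2R + a` of the plaquette at `R` (coordinatewise; `L = 2M`).
[cite: YaoTsaiKivelson2007, Fig. 1] -/
def plaqSite (R : FermionTorus 2 M) (a : PlaquetteSite) : FermionTorus 2 (2 * M) :=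
  toLex fun i => ⟨2 * (ofLex R i : ℕ) + (ofLex a i : ℕ), by
    have h1 := (ofLex R i).isLt
    have h2 := (ofLex a i).isLt
    omega⟩

/-- Coordinates of `plaqSite`. [folklore] -/
@[simp] theorem plaqSite_apply_val (R : FermionTorus 2 M) (a : PlaquetteSite) (i : Fin 2) :
    ((ofLex (plaqSite M R a)) i : ℕ) = 2 * (ofLex R i : ℕ) + (ofLex a i : ℕ) := rfl

/-- **`a ↦ 2R + a` is strictly monotone** for the lexicographic site orders (it preserves each
coordinate's order and equalities). [folklore] -/
theorem plaqSite_strictMono (R : FermionTorus 2 M) : StrictMono (plaqSite M R) := by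
  intro a b hab
  obtain ⟨i, hi, hlt⟩ : ∃ i, (∀ j, j < i → (ofLex a) j = (ofLex b) j) ∧ (ofLex a) i < (ofLex b) i := hab
  show ∃ i, (∀ j, j < i → ofLex (plaqSite M R a) j = ofLex (plaqSite M R b) j) ∧
    ofLex (plaqSite M R a) i < ofLex (plaqSite M R b) i
  refine ⟨i, fun j hj => ?_, ?_⟩
  · apply Fin.ext
    rw [plaqSite_apply_val, plaqSite_apply_val, hi j hj]
  · rw [Fin.lt_def, plaqSite_apply_val, plaqSite_apply_val]
    have h := Fin.lt_def.1 hlt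
    omega

/-- The plaquette at `R` as an order embedding of sites. [folklore] -/
def plaqSiteEmb (R : FermionTorus 2 M) : PlaquetteSite ↪o FermionTorus 2 (2 * M) :=
  OrderEmbedding.ofStrictMono _ (plaqSite_strictMono M R)

/-- `plaqSiteEmb` is `plaqSite`. [folklore] -/
@[simp] theorem plaqSiteEmb_apply (R : FermionTorus 2 M) (a : PlaquetteSite) :
    plaqSiteEmb M R a = plaqSite M R a := rfl

/-- The plaquette at `R` as an order embedding of ORBITALS, `(x, σ) ↦ (2R + x, σ)`. [folklore] -/
def plaqOrbEmb (R : FermionTorus 2 M) : Orb PlaquetteSite ↪o Orb (FermionTorus 2 (2 * M)) :=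
  orbEmb (plaqSiteEmb M R)

/-- `plaqOrbEmb` on an orbital. [folklore] -/
@[simp] theorem plaqOrbEmb_orb (R : FermionTorus 2 M) (a : PlaquetteSite) (σ : Fin 2) :
    plaqOrbEmb M R (orb a σ) = orb (plaqSite M R a) σ := rfl

/-- The plaquette (block) of a site: `x ↦ x / 2` coordinatewise. [folklore] -/
def blockOf (x : FermionTorus 2 (2 * M)) : FermionTorus 2 M :=
  toLex fun i => ⟨(ofLex x i : ℕ) / 2, by
    have h := (ofLex x i).isLt
    omega⟩

/-- The position of a site inside its plaquette: `x ↦ x % 2` coordinatewise. [folklore] -/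
def posOf (x : FermionTorus 2 (2 * M)) : PlaquetteSite :=
  toLex fun i => ⟨(ofLex x i : ℕ) % 2, Nat.mod_lt _ two_pos⟩

/-- Coordinates of `blockOf`. [folklore] -/
@[simp] theorem blockOf_apply_val (x : FermionTorus 2 (2 * M)) (i : Fin 2) :
    ((ofLex (blockOf M x)) i : ℕ) = (ofLex x i : ℕ) / 2 := rfl

/-- Coordinates of `posOf`. [folklore] -/
@[simp] theorem posOf_apply_val (x : FermionTorus 2 (2 * M)) (i : Fin 2) :
    ((ofLex (posOf M x)) i : ℕ) = (ofLex x i : ℕ) % 2 := rfl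

/-- `2 (x / 2) + x % 2 = x`: a site is the `posOf`-th site of its plaquette. [folklore] -/
theorem plaqSite_blockOf_posOf (x : FermionTorus 2 (2 * M)) : plaqSite M (blockOf M x) (posOf M x) = x := by
  change toLex _ = x
  rw [← toLex_ofLex x]
  congr 1
  funext i
  apply Fin.ext
  simp only [toLex_ofLex]
  change 2 * ((ofLex x i : ℕ) / 2) + (ofLex x i : ℕ) % 2 = (ofLex x i : ℕ)
  exact Nat.div_add_mod _ 2

/-- `(2R + a) / 2 = R`. [folklore] -/
theorem blockOf_plaqSite (R : FermionTorus 2 M) (a : PlaquetteSite) : blockOf M (plaqSite M R a) = R := by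
  change toLex _ = R
  rw [← toLex_ofLex R]
  congr 1
  funext i
  apply Fin.ext
  simp only [plaqSite_apply_val, toLex_ofLex]
  have h := (ofLex a i).isLt
  omega

/-- `(2R + a) % 2 = a`. [folklore] -/
theorem posOf_plaqSite (R : FermionTorus 2 M) (a : PlaquetteSite) : posOf M (plaqSite M R a) = a := by
  change toLex _ = a
  rw [← toLex_ofLex a]
  congr 1
  funext i
  apply Fin.ext
  simp only [plaqSite_apply_val, toLex_ofLex]
  have h := (ofLex a i).isLt
  omega

/-- **The plaquette partition of the `2M`-torus**: clusters = plaquettes `R : FermionTorus 2 M`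
(lexicographic order), internal orbitals `Orb PlaquetteSite`, embeddings `plaqOrbEmb`.
[cite: YaoTsaiKivelson2007, Fig. 1] -/
def plaquettePartition :
    ClusterProduct.Partition (Orb (FermionTorus 2 (2 * M))) (FermionTorus 2 M) (Orb PlaquetteSite) where
  emb R := plaqOrbEmb M R
  cl o := blockOf M (ofLex o).1
  idx o := orb (posOf M (ofLex o).1) (ofLex o).2
  emb_cl_idx o := by
    change orb (plaqSite M (blockOf M (ofLex o).1) (posOf M (ofLex o).1)) (ofLex o).2 = o
    rw [plaqSite_blockOf_posOf]
    rfl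
  cl_emb R a := by
    change blockOf M (plaqSite M R (ofLex a).1) = R
    exact blockOf_plaqSite M R _
  idx_emb R a := by
    change orb (posOf M (plaqSite M R (ofLex a).1)) (ofLex a).2 = a
    rw [posOf_plaqSite]
    rfl

/-- The embeddings of the plaquette partition. [folklore] -/
@[simp] theorem plaquettePartition_emb (R : FermionTorus 2 M) : (plaquettePartition M).emb R = plaqOrbEmb M R := rfl

/-- The cluster of an orbital is the block of its site. [folklore] -/
@[simp] theorem plaquettePartition_cl (o : Orb (FermionTorus 2 (2 * M))) :
    (plaquettePartition M).cl o = blockOf M (ofLex o).1 := rfl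

/-- **Same plaquette ↔ same block** in the summit's block map `x ↦ (fun i => (x i : ℕ) / 2)`.
[folklore] -/
theorem blockOf_eq_iff (x y : FermionTorus 2 (2 * M)) :
    blockOf M x = blockOf M y ↔ (fun i : Fin 2 => ((ofLex x) i : ℕ) / 2) = fun i => ((ofLex y) i : ℕ) / 2 := by
  constructor
  · intro h
    funext i
    have hi := congrArg (fun z => ((ofLex z) i : ℕ)) h
    rw [blockOf_apply_val, blockOf_apply_val] at hi
    exact hi
  · intro h
    change toLex _ = toLex _
    congr 1
    funext i
    apply Fin.ext
    simpa using congrFun h i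

end TorusPlaquette

end Literature.MathematicalPhysics.QuantumLattice

end
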